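import Summits.ValiantsHypothesis.ValiantsHypothesis.Theorems.NewtonUnitEquationsTwoProductsMomentRecordLiftTransfer
import Summits.ValiantsHypothesis.ValiantsHypothesis.Theorems.NewtonUnitEquationsTwoProductsPlanarCellCharging

/-!
# R12 lift toolkit — the lumped free model of `X ⊔ (X+d)`

(3/5) The LUMPED FREE MODEL of an instance with tail alphabet in `X ⊔ (X+d)`: variables `y_i` (carriers) and `z` (shift marker), the planar point `pt` of an exponent (= the landed `ptZ` of its pair `(S,k)`), the model weight `κw` with `lw κw E = wtZ ξ (pt E)`, letter exponents `yExp`/`yzExp`, dissociation in exponent form (`pt_injOn_shallow`), the LETTER LIFT `λ` (`pt (λ e) = e`), lifted tails `liftW`/`ellU`/`ellV`, the tuple expansion of a lifted product, and UP = DOWN on tuple classes under depth-`m` `CarrierDissociated` (`coeff_deltaUp_tupleExp`): deep letter-multisets never enter `Π(1+u) − Π(1+v)`.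
Helper on crux `stmt-ValiantsHypothesis-5906` (line `relation_ladder`, R12 «moment record law», crit-8 g2's texts ✓ `…MomentRecordDefs` / `…MomentRecordRungDefs`); `--supports`, closes nothing by itself: (A∘) `MomentRecordLawUsed`, the rung (B), `PlanarCellBound` and the crux stay OPEN; VP ≠ VNP is NOT proved.  No instances, no notation, no named facts. [folklore]
-/

set_option linter.dupNamespace false

noncomputable section

open Classical

namespace Summit.ValiantsHypothesis.ValiantsHypothesis.Theorems.NewtonUnitEquations.TwoProducts.MomentRecord.Lift
open scoped BigOperators
open MvPolynomial

section ModelFile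

/-! ## The lumped free model of `X ⊔ (X + d)`: variables `y_i = X (some i)` (carriers) and `z = X none` (the shift marker) -/

section Model
open Summit.ValiantsHypothesis.ValiantsHypothesis.Theorems.NewtonUnitEquations.TwoProducts.FormalLogLinearisation
open Summit.ValiantsHypothesis.ValiantsHypothesis.Theorems.NewtonUnitEquations.TwoProducts.PlanarCell
open Summit.ValiantsHypothesis.ValiantsHypothesis.Theorems.NewtonUnitEquations.TwoProducts.MomentRecord

variable {m n : ℕ}

/-- An exponent of `ℕ²` as an integer point. [folklore] -/
def ιZ (e : Expo) : Fin 2 → ℤ := fun c => ((e c : ℕ) : ℤ)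

/-- `ιZ` is injective. [folklore] -/
theorem ιZ_injective : Function.Injective ιZ := by
  intro e e' h
  ext c
  have := congr_fun h c
  simpa [ιZ] using this

/-- `ιZ` is additive. [folklore] -/
theorem ιZ_add (e e' : Expo) : ιZ (e + e') = ιZ e + ιZ e' := by
  ext c; simp [ιZ]

/-- `ιZ 0 = 0`. [folklore] -/
theorem ιZ_zero : ιZ 0 = 0 := by ext c; simp [ιZ]

/-- `ιZ` of a finite sum. [folklore] -/
theorem ιZ_sum {ι : Type*} (s : Finset ι) (f : ι → Expo) : ιZ (∑ i ∈ s, f i) = ∑ i ∈ s, ιZ (f i) := by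
  classical
  induction s using Finset.induction_on with
  | empty => simp [ιZ_zero]
  | insert a s ha ih => rw [Finset.sum_insert ha, Finset.sum_insert ha, ιZ_add, ih]

/-- The weight of an embedded exponent is its weight. [folklore] -/
theorem wtZ_ιZ (ξ : Fin 2 → ℝ) (e : Expo) : wtZ ξ (ιZ e) = wt ξ e := by
  simp [wtZ, wt, ιZ]

/-- The planar point of an upstairs exponent `E`: `Σ_i E(y_i) • x_i + E(z) • d` (`= ptZ x d S_E k_E`). [folklore] -/
def pt (x : Fin n → Expo) (d : Fin 2 → ℤ) (E : Option (Fin n) →₀ ℕ) : Fin 2 → ℤ :=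
  fun c => (∑ i, ((E (some i) : ℕ) : ℤ) * ((x i c : ℕ) : ℤ)) + ((E none : ℕ) : ℤ) * d c

/-- `pt` is the landed `ptZ` of the pair `(S_E, k_E)`. [folklore] -/
theorem pt_eq_ptZ (x : Fin n → Expo) (d : Fin 2 → ℤ) (E : Option (Fin n) →₀ ℕ) :
    pt x d E = ptZ x d (fun i => E (some i)) (E none) := rfl

/-- `pt` is additive. [folklore] -/
theorem pt_add (x : Fin n → Expo) (d : Fin 2 → ℤ) (E E' : Option (Fin n) →₀ ℕ) :
    pt x d (E + E') = pt x d E + pt x d E' := by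
  ext c
  simp only [pt, Finsupp.add_apply, Nat.cast_add, add_mul, Finset.sum_add_distrib, Pi.add_apply]
  ring

/-- `pt 0 = 0`. [folklore] -/
theorem pt_zero (x : Fin n → Expo) (d : Fin 2 → ℤ) : pt x d 0 = 0 := by
  ext c; simp [pt]

/-- `pt` of a finite sum. [folklore] -/
theorem pt_sum {ι : Type*} (x : Fin n → Expo) (d : Fin 2 → ℤ) (s : Finset ι) (f : ι → Option (Fin n) →₀ ℕ) :
    pt x d (∑ i ∈ s, f i) = ∑ i ∈ s, pt x d (f i) := by
  classical
  induction s using Finset.induction_on with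
  | empty => simp [pt_zero]
  | insert a s ha ih => rw [Finset.sum_insert ha, Finset.sum_insert ha, pt_add, ih]

/-- The weight vector of the model: carriers weigh `wt ξ (x i)`, the shift marker weighs `wtZ ξ d`. [folklore] -/
def κw (ξ : Fin 2 → ℝ) (x : Fin n → Expo) (d : Fin 2 → ℤ) : Option (Fin n) → ℝ :=
  fun v => Option.elim v (wtZ ξ d) fun i => wt ξ (x i)

/-- The linear weight of an upstairs exponent is the weight of its planar point. [folklore] -/
theorem lw_κw (ξ : Fin 2 → ℝ) (x : Fin n → Expo) (d : Fin 2 → ℤ) (E : Option (Fin n) →₀ ℕ) :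
    lw (κw ξ x d) E = wtZ ξ (pt x d E) := by
  rw [lw, Fintype.sum_option]
  simp only [κw, Option.elim, wtZ, pt, wt, Int.cast_add, Int.cast_mul, Int.cast_sum, Int.cast_natCast]
  have h : ∑ i, ((E (some i) : ℕ) : ℝ) * (ξ 0 * ((x i 0 : ℕ) : ℝ) + ξ 1 * ((x i 1 : ℕ) : ℝ)) =
      ξ 0 * ∑ i, ((E (some i) : ℕ) : ℝ) * ((x i 0 : ℕ) : ℝ) + ξ 1 * ∑ i, ((E (some i) : ℕ) : ℝ) * ((x i 1 : ℕ) : ℝ) := by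
    rw [Finset.mul_sum, Finset.mul_sum, ← Finset.sum_add_distrib]
    exact Finset.sum_congr rfl fun i _ => by ring
  rw [h]
  ring

/-- The exponent of the carrier letter `x_i`: `y_i`. [folklore] -/
def yExp (i : Fin n) : Option (Fin n) →₀ ℕ := Finsupp.single (some i) 1

/-- The exponent of the shifted letter `x_i + d`: `y_i z`. [folklore] -/
def yzExp (i : Fin n) : Option (Fin n) →₀ ℕ := Finsupp.single (some i) 1 + Finsupp.single none 1

/-- `pt (y_i) = x_i`. [folklore] -/
theorem pt_yExp (x : Fin n → Expo) (d : Fin 2 → ℤ) (i : Fin n) : pt x d (yExp i) = ιZ (x i) := by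
  classical
  ext c
  simp only [pt, yExp, ιZ]
  rw [Finset.sum_eq_single i (fun j _ hj => by simp [hj]) (by simp)]
  simp

/-- `pt (y_i z) = x_i + d`. [folklore] -/
theorem pt_yzExp (x : Fin n → Expo) (d : Fin 2 → ℤ) (i : Fin n) : pt x d (yzExp i) = shiftZ x d i := by
  classical
  ext c
  simp only [pt, yzExp, shiftZ, Finsupp.add_apply]
  rw [Finset.sum_eq_single i (fun j _ hj => by simp [hj]) (by simp)]
  simp

/-- The `y`-degree (number of letters) of an upstairs exponent. [folklore] -/
def ydeg (E : Option (Fin n) →₀ ℕ) : ℕ := ∑ i, E (some i)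

/-- `ydeg` is additive. [folklore] -/
theorem ydeg_add (E E' : Option (Fin n) →₀ ℕ) : ydeg (E + E') = ydeg E + ydeg E' := by
  simp [ydeg, Finset.sum_add_distrib]

/-- `ydeg` of a finite sum. [folklore] -/
theorem ydeg_sum {ι : Type*} (s : Finset ι) (f : ι → Option (Fin n) →₀ ℕ) : ydeg (∑ i ∈ s, f i) = ∑ i ∈ s, ydeg (f i) := by
  classical
  induction s using Finset.induction_on with
  | empty => simp [ydeg]
  | insert a s ha ih => rw [Finset.sum_insert ha, Finset.sum_insert ha, ydeg_add, ih]

/-- `ydeg (y_i) = 1`, `(y_i)(z) = 0`. [folklore] -/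
theorem ydeg_yExp (i : Fin n) : ydeg (yExp i) = 1 ∧ yExp i none = 0 := by
  classical
  refine ⟨?_, by simp [yExp]⟩
  simp only [ydeg, yExp]
  rw [Finset.sum_eq_single i (fun j _ hj => by simp [hj]) (by simp)]
  simp

/-- `ydeg (y_i z) = 1`, `(y_i z)(z) = 1`. [folklore] -/
theorem ydeg_yzExp (i : Fin n) : ydeg (yzExp i) = 1 ∧ yzExp i none = 1 := by
  classical
  refine ⟨?_, by simp [yzExp]⟩
  simp only [ydeg, yzExp, Finsupp.add_apply]
  rw [Finset.sum_eq_single i (fun j _ hj => by simp [hj]) (by simp)]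
  simp

/-- `ydeg E` is the `size` of the carrier multiset of `E`. [folklore] -/
theorem ydeg_eq_size (E : Option (Fin n) →₀ ℕ) : ydeg E = size fun i => E (some i) := rfl

/-- DISSOCIATION in exponent form: `pt` is injective on SHALLOW exponents (`ydeg ≤ m`, `E(z) ≤ ydeg`). [folklore] -/
theorem pt_injOn_shallow {x : Fin n → Expo} {d : Fin 2 → ℤ} (hdis : CarrierDissociated x d m)
    {E E' : Option (Fin n) →₀ ℕ} (hE : ydeg E ≤ m) (hk : E none ≤ ydeg E) (hE' : ydeg E' ≤ m) (hk' : E' none ≤ ydeg E')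
    (h : pt x d E = pt x d E') : E = E' := by
  rw [pt_eq_ptZ, pt_eq_ptZ] at h
  obtain ⟨hS, hkk⟩ := hdis _ _ _ _ hE hE' hk hk' h
  ext v
  cases v with
  | none => exact hkk
  | some i => exact congr_fun hS i

/-! ### Letters and their lifts -/

variable (u v : Fin m → MvPolynomial (Fin 2) ℂ) (x : Fin n → Expo) (d : Fin 2 → ℤ)

/-- `E` is a LETTER EXPONENT of the tail letter `e`: `E = y_i` with `e = x_i`, or `E = y_i z` with `e = x_i + d`. [folklore] -/
def IsLetterExp (e : Expo) (E : Option (Fin n) →₀ ℕ) : Prop :=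
  ∃ i, (E = yExp i ∧ e = x i) ∨ (E = yzExp i ∧ ιZ e = shiftZ x d i)

/-- The LETTER LIFT `λ`: a chosen letter exponent for tail letters, `0` elsewhere (in particular `λ 0 = 0`). [folklore] -/
def lam (e : Expo) : Option (Fin n) →₀ ℕ :=
  if h : e ∈ tailSupport u v ∧ ∃ E, IsLetterExp x d e E then Classical.choose h.2 else 0

variable {u v x d}

/-- Under the alphabet hypothesis every tail letter has a letter exponent. [folklore] -/
theorem exists_isLetterExp (halph : ∀ e ∈ tailSupport u v, ∃ i, e = x i ∨ ∀ c, ((e c : ℕ) : ℤ) = shiftZ x d i c)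
    {e : Expo} (he : e ∈ tailSupport u v) : ∃ E, IsLetterExp x d e E := by
  obtain ⟨i, h⟩ := halph e he
  rcases h with h | h
  · exact ⟨yExp i, i, Or.inl ⟨rfl, h⟩⟩
  · exact ⟨yzExp i, i, Or.inr ⟨rfl, funext h⟩⟩

/-- The lift of a tail letter is a letter exponent. [folklore] -/
theorem isLetterExp_lam (halph : ∀ e ∈ tailSupport u v, ∃ i, e = x i ∨ ∀ c, ((e c : ℕ) : ℤ) = shiftZ x d i c)
    {e : Expo} (he : e ∈ tailSupport u v) : IsLetterExp x d e (lam u v x d e) := by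
  have h : e ∈ tailSupport u v ∧ ∃ E, IsLetterExp x d e E := ⟨he, exists_isLetterExp halph he⟩
  rw [lam, dif_pos h]
  exact Classical.choose_spec h.2

/-- Off the tail support the lift is `0`. [folklore] -/
theorem lam_of_not_mem {e : Expo} (he : e ∉ tailSupport u v) : lam u v x d e = 0 := by
  rw [lam, dif_neg (fun h => he h.1)]

/-- The constant exponent is never a tail letter of a normalised instance, so `λ 0 = 0`. [folklore] -/
theorem zero_not_mem_tailSupport (hu : ∀ j, coeff 0 (u j) = 0) (hv : ∀ j, coeff 0 (v j) = 0) :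
    (0 : Expo) ∉ tailSupport u v := by
  intro h
  rw [tailSupport, Finset.mem_union, Finset.mem_biUnion, Finset.mem_biUnion] at h
  rcases h with ⟨j, _, hj⟩ | ⟨j, _, hj⟩
  · exact (mem_support_iff.mp hj) (hu j)
  · exact (mem_support_iff.mp hj) (hv j)

/-- A letter exponent projects to its letter, has one carrier letter, and at most one shift. [folklore] -/
theorem IsLetterExp.pt_eq {e : Expo} {E : Option (Fin n) →₀ ℕ} (h : IsLetterExp x d e E) :
    pt x d E = ιZ e ∧ ydeg E = 1 ∧ E none ≤ 1 := by
  obtain ⟨i, h | h⟩ := h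
  · obtain ⟨rfl, rfl⟩ := h
    exact ⟨pt_yExp x d i, (ydeg_yExp i).1, by rw [(ydeg_yExp i).2]; exact zero_le_one⟩
  · obtain ⟨rfl, he⟩ := h
    exact ⟨(pt_yzExp x d i).trans he.symm, (ydeg_yzExp i).1, by rw [(ydeg_yzExp i).2]⟩

/-- The lift projects back to the letter: `pt (λ e) = e` on `tailSupport ∪ {0}` (normalised instance). [folklore] -/
theorem pt_lam (hu : ∀ j, coeff 0 (u j) = 0) (hv : ∀ j, coeff 0 (v j) = 0)
    (halph : ∀ e ∈ tailSupport u v, ∃ i, e = x i ∨ ∀ c, ((e c : ℕ) : ℤ) = shiftZ x d i c)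
    {e : Expo} (he : e ∈ insert (0 : Expo) (tailSupport u v)) : pt x d (lam u v x d e) = ιZ e := by
  rcases Finset.mem_insert.mp he with rfl | he
  · rw [lam_of_not_mem (zero_not_mem_tailSupport hu hv), pt_zero, ιZ_zero]
  · exact (isLetterExp_lam halph he).pt_eq.1

/-- Shape of the lift: `ydeg (λ e) ≤ 1` and `(λ e)(z) ≤ ydeg (λ e)`. [folklore] -/
theorem ydeg_lam_le (halph : ∀ e ∈ tailSupport u v, ∃ i, e = x i ∨ ∀ c, ((e c : ℕ) : ℤ) = shiftZ x d i c) (e : Expo) :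
    ydeg (lam u v x d e) ≤ 1 ∧ (lam u v x d e) none ≤ ydeg (lam u v x d e) := by
  by_cases he : e ∈ tailSupport u v
  · obtain ⟨_, h1, h2⟩ := (isLetterExp_lam halph he).pt_eq
    exact ⟨h1.le, by rw [h1]; exact h2⟩
  · rw [lam_of_not_mem he]
    simp [ydeg]

/-- Tuples of letters (`0` = no letter): the exponent `E_a = Σ_j λ(a_j)` of a tuple is SHALLOW. [folklore] -/
theorem shallow_tupleExp (halph : ∀ e ∈ tailSupport u v, ∃ i, e = x i ∨ ∀ c, ((e c : ℕ) : ℤ) = shiftZ x d i c)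
    (a : Fin m → Expo) : ydeg (∑ j, lam u v x d (a j)) ≤ m ∧ (∑ j, lam u v x d (a j)) none ≤ ydeg (∑ j, lam u v x d (a j)) := by
  rw [ydeg_sum, Finsupp.finsetSum_apply]
  refine ⟨?_, Finset.sum_le_sum fun j _ => (ydeg_lam_le halph (a j)).2⟩
  calc ∑ j, ydeg (lam u v x d (a j)) ≤ ∑ _j : Fin m, 1 := Finset.sum_le_sum fun j _ => (ydeg_lam_le halph (a j)).1
    _ = m := by simp

/-! ### Lifted tails and the tuple expansion up and down -/

/-- The LIFT of a tail along an exponent map `g`: `Σ_{e ∈ supp w} [e]w · Y^{g e}`. [folklore] -/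
def liftW {τ : Type*} (g : Expo → τ →₀ ℕ) (w : MvPolynomial (Fin 2) ℂ) : MvPolynomial τ ℂ :=
  ∑ e ∈ w.support, monomial (g e) (coeff e w)

/-- `1 + lift w = Σ_{e ∈ A ∪ {0}} ŵ(e) Y^{g e}` for a tail `w` supported in `A ∌ 0`, when `g 0 = 0`. [folklore] -/
theorem one_add_liftW_eq {τ : Type*} [DecidableEq τ] (g : Expo → τ →₀ ℕ) (hg : g 0 = 0) (w : MvPolynomial (Fin 2) ℂ) (A : Finset Expo)
    (h0 : (0 : Expo) ∉ A) (hw : w.support ⊆ A) :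
    1 + liftW g w = ∑ e ∈ insert 0 A, monomial (g e) (hatCoeff w e) := by
  classical
  rw [Finset.sum_insert h0]
  have h1 : (monomial (g 0) (hatCoeff w 0) : MvPolynomial τ ℂ) = 1 := by simp [hatCoeff, hg]
  rw [h1]
  congr 1
  have hsum : ∑ e ∈ A, monomial (g e) (hatCoeff w e) = ∑ e ∈ A, (monomial (g e) (coeff e w) : MvPolynomial τ ℂ) := by
    refine Finset.sum_congr rfl fun e he => ?_
    have hne : e ≠ 0 := fun h => h0 (h ▸ he)
    simp [hatCoeff, hne]
  rw [hsum, liftW]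
  exact Finset.sum_subset hw fun e _ he => by rw [notMem_support_iff.1 he, map_zero]

/-- **Tuple expansion of a lifted product.** `∏_j (1 + lift w_j) = Σ_{a ∈ ∏(A_j ∪ {0})} (∏_j ŵ_j(a_j)) Y^{Σ_j g(a_j)}`. [folklore] -/
theorem prod_one_add_liftW_eq {τ : Type*} [DecidableEq τ] (g : Expo → τ →₀ ℕ) (hg : g 0 = 0) (w : Fin m → MvPolynomial (Fin 2) ℂ)
    (A : Fin m → Finset Expo) (h0 : ∀ j, (0 : Expo) ∉ A j) (hw : ∀ j, (w j).support ⊆ A j) :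
    ∏ j, (1 + liftW g (w j)) = ∑ a ∈ Fintype.piFinset (fun j => insert 0 (A j)),
      monomial (∑ j, g (a j)) (∏ j, hatCoeff (w j) (a j)) := by
  classical
  have h : ∏ j, (1 + liftW g (w j)) = ∏ j, ∑ e ∈ insert 0 (A j), (monomial (g e) (hatCoeff (w j) e) : MvPolynomial τ ℂ) :=
    Finset.prod_congr rfl fun j _ => one_add_liftW_eq g hg (w j) (A j) (h0 j) (hw j)
  rw [h, Finset.prod_univ_sum]
  refine Finset.sum_congr rfl fun a _ => ?_
  rw [monomial_sum_prod]

/-- Coefficients of a lifted product are FIBRE SUMS over tuples. [folklore] -/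
theorem coeff_prod_one_add_liftW {τ : Type*} [DecidableEq τ] (g : Expo → τ →₀ ℕ) (hg : g 0 = 0) (w : Fin m → MvPolynomial (Fin 2) ℂ)
    (A : Fin m → Finset Expo) (h0 : ∀ j, (0 : Expo) ∉ A j) (hw : ∀ j, (w j).support ⊆ A j) (E : τ →₀ ℕ) :
    coeff E (∏ j, (1 + liftW g (w j))) =
      ∑ a ∈ (Fintype.piFinset (fun j => insert 0 (A j))).filter (fun a => ∑ j, g (a j) = E),
        ∏ j, hatCoeff (w j) (a j) := by
  classical
  rw [prod_one_add_liftW_eq g hg w A h0 hw, coeff_sum, Finset.sum_filter]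
  refine Finset.sum_congr rfl fun a _ => ?_
  rw [coeff_monomial]

/-- The identity lift is the tail itself. [folklore] -/
theorem liftW_id (w : MvPolynomial (Fin 2) ℂ) : liftW (fun e => e) w = w := by
  rw [liftW]; exact (as_sum w).symm

/-- The upstairs tails of the instance: `ℓU j = Σ_e [e]u_j Y^{λ e}`, `ℓV j` likewise. [folklore] -/
def ellU (j : Fin m) : MvPolynomial (Option (Fin n)) ℂ := liftW (lam u v x d) (u j)

/-- The upstairs `v`-tails. [folklore] -/
def ellV (j : Fin m) : MvPolynomial (Option (Fin n)) ℂ := liftW (lam u v x d) (v j)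

/-- The upstairs difference of products `𝚫 = ∏ (1 + ℓU_j) − ∏ (1 + ℓV_j)`. [folklore] -/
def DeltaUp : MvPolynomial (Option (Fin n)) ℂ := ∏ j, (1 + ellU (u := u) (v := v) (x := x) (d := d) j) - ∏ j, (1 + ellV (u := u) (v := v) (x := x) (d := d) j)

/-- **Dissociated comparison of fibres.** For a letter tuple `a`, the tuples with the same UPSTAIRS exponent are exactly the tuples with the
same DOWNSTAIRS point. [folklore] -/
theorem filter_tupleExp_eq (hu : ∀ j, coeff 0 (u j) = 0) (hv : ∀ j, coeff 0 (v j) = 0)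
    (halph : ∀ e ∈ tailSupport u v, ∃ i, e = x i ∨ ∀ c, ((e c : ℕ) : ℤ) = shiftZ x d i c) (hdis : CarrierDissociated x d m)
    (A : Fin m → Finset Expo) (hA : ∀ j, A j ⊆ tailSupport u v) {a : Fin m → Expo}
    (ha : a ∈ Fintype.piFinset (fun j => insert 0 (A j))) :
    (Fintype.piFinset (fun j => insert 0 (A j))).filter (fun b => ∑ j, lam u v x d (b j) = ∑ j, lam u v x d (a j)) =
      (Fintype.piFinset (fun j => insert 0 (A j))).filter (fun b => ∑ j, b j = ∑ j, a j) := by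
  classical
  have hmem : ∀ b ∈ Fintype.piFinset (fun j => insert 0 (A j)), ∀ j, b j ∈ insert (0 : Expo) (tailSupport u v) := by
    intro b hb j
    have := Fintype.mem_piFinset.mp hb j
    rcases Finset.mem_insert.mp this with h | h
    · exact Finset.mem_insert.mpr (Or.inl h)
    · exact Finset.mem_insert_of_mem (hA j h)
  have hpt : ∀ b ∈ Fintype.piFinset (fun j => insert 0 (A j)), pt x d (∑ j, lam u v x d (b j)) = ιZ (∑ j, b j) := by
    intro b hb
    rw [pt_sum, ιZ_sum]
    exact Finset.sum_congr rfl fun j _ => pt_lam hu hv halph (hmem b hb j)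
  ext b
  simp only [Finset.mem_filter, and_congr_right_iff]
  intro hb
  constructor
  · intro h
    have := hpt b hb
    rw [h, hpt a ha] at this
    exact ιZ_injective this.symm
  · intro h
    have h1 := hpt b hb
    rw [h, ← hpt a ha] at h1
    obtain ⟨s1, s2⟩ := shallow_tupleExp halph b
    obtain ⟨t1, t2⟩ := shallow_tupleExp halph a
    exact pt_injOn_shallow hdis s1 s2 t1 t2 h1

/-- **Up = down on tuple classes.** Under depth-`m` dissociation the upstairs coefficient of `𝚫` at a tuple exponent is the downstairs
coefficient of `tailDiff u v` at the tuple's point. [folklore] -/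
theorem coeff_deltaUp_tupleExp (hu : ∀ j, coeff 0 (u j) = 0) (hv : ∀ j, coeff 0 (v j) = 0)
    (halph : ∀ e ∈ tailSupport u v, ∃ i, e = x i ∨ ∀ c, ((e c : ℕ) : ℤ) = shiftZ x d i c) (hdis : CarrierDissociated x d m)
    {a : Fin m → Expo} (ha : a ∈ Fintype.piFinset (fun _ : Fin m => insert (0 : Expo) (tailSupport u v))) :
    coeff (∑ j, lam u v x d (a j)) (DeltaUp (u := u) (v := v) (x := x) (d := d)) = coeff (∑ j, a j) (tailDiff u v) := by
  classical
  have h0 : (0 : Expo) ∉ tailSupport u v := zero_not_mem_tailSupport hu hv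
  have hlam0 : lam u v x d 0 = 0 := lam_of_not_mem h0
  have huA : ∀ j, (u j).support ⊆ tailSupport u v := fun j e he =>
    Finset.mem_union_left _ (Finset.mem_biUnion.mpr ⟨j, Finset.mem_univ _, he⟩)
  have hvA : ∀ j, (v j).support ⊆ tailSupport u v := fun j e he =>
    Finset.mem_union_right _ (Finset.mem_biUnion.mpr ⟨j, Finset.mem_univ _, he⟩)
  have hfil := filter_tupleExp_eq hu hv halph hdis (fun _ => tailSupport u v) (fun _ => le_rfl) ha
  rw [DeltaUp, coeff_sub, tailDiff, coeff_sub]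
  unfold ellU ellV
  rw [coeff_prod_one_add_liftW _ hlam0 u _ (fun _ => h0) huA, coeff_prod_one_add_liftW _ hlam0 v _ (fun _ => h0) hvA, hfil,
    ← coeff_prod_one_add_eq_fibreSum u _ (fun _ => h0) huA, ← coeff_prod_one_add_eq_fibreSum v _ (fun _ => h0) hvA]

/-- Every upstairs exponent in the support of `𝚫` is a tuple exponent. [folklore] -/
theorem exists_tuple_of_coeff_deltaUp_ne_zero (hu : ∀ j, coeff 0 (u j) = 0) (hv : ∀ j, coeff 0 (v j) = 0)
    {E : Option (Fin n) →₀ ℕ} (hE : coeff E (DeltaUp (u := u) (v := v) (x := x) (d := d)) ≠ 0) :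
    ∃ a ∈ Fintype.piFinset (fun _ : Fin m => insert (0 : Expo) (tailSupport u v)), ∑ j, lam u v x d (a j) = E := by
  classical
  have h0 : (0 : Expo) ∉ tailSupport u v := zero_not_mem_tailSupport hu hv
  have hlam0 : lam u v x d 0 = 0 := lam_of_not_mem h0
  have huA : ∀ j, (u j).support ⊆ tailSupport u v := fun j e he =>
    Finset.mem_union_left _ (Finset.mem_biUnion.mpr ⟨j, Finset.mem_univ _, he⟩)
  have hvA : ∀ j, (v j).support ⊆ tailSupport u v := fun j e he =>
    Finset.mem_union_right _ (Finset.mem_biUnion.mpr ⟨j, Finset.mem_univ _, he⟩)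
  by_contra hne
  push Not at hne
  apply hE
  rw [DeltaUp, coeff_sub]
  unfold ellU ellV
  rw [coeff_prod_one_add_liftW _ hlam0 u _ (fun _ => h0) huA, coeff_prod_one_add_liftW _ hlam0 v _ (fun _ => h0) hvA]
  have hempty : (Fintype.piFinset (fun _ : Fin m => insert (0 : Expo) (tailSupport u v))).filter
      (fun a => ∑ j, lam u v x d (a j) = E) = ∅ := by
    rw [Finset.filter_eq_empty_iff]
    exact fun a ha h => hne a ha h
  rw [hempty, Finset.sum_empty, Finset.sum_empty, sub_self]

end Model

end ModelFile

end Summit.ValiantsHypothesis.ValiantsHypothesis.Theorems.NewtonUnitEquations.TwoProducts.MomentRecord.Lift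

end
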